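import Literature.Computability.Cryptography.LWEPiLawMaps
import Mathlib.Algebra.BigOperators.Fin
import HarnessLib

/-!
# Zipping independent iid families, nesting blocks, and uniform chunks of a coin string as uniform residues mod `2ᵉ`

Topic `Computability/Cryptography` (LWE toolkit), grouping namespace `LWE`, sequel of
`LWEPiLawMaps.lean` and `LWEProductLaws.lean` (`prodLaw_iidPMF_map_zip`, `iidPMF_map_blocksOf`,
`iidPMF_map_appendEquiv_symm`). Generic, proved material (no named fact), written for the machine
bridge of the Micciancio–Peikert reduction (`LWEPrimePower*.lean`, towards
`blprs_gapSVP_sqrt_dim_to_lwe_classical`, **pqc.S21**): the machine's raw material comes in FLAT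
streams (the input samples; the coin string) which it cuts into consecutive segments and nested blocks
and zips together into the structured items of the analysis; these lemmas carry the flat iid laws to
the nested, zipped ones.

* `zip_iid₁` … `zip_iid₄` — zipping two independent iid nests of depth `1 … 4` gives the iid nest of
  the product law.
* `blocks₂`, `blocks₃`, `blocks₄` with `iidPMF_map_blocks₂` … — cutting an iid stream of length
  `a·(b·…)` into nested consecutive blocks gives the iid nest.
* `chunkVal` (the residue mod `2ᵉ` with binary digits a chunk of `e` coins), `chunkVal_injective`,
  **`uniformOfFintype_map_chunkVal`** (a uniform chunk gives a uniform residue — exact because the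
  modulus is a power of `2`), `iidPMF_uniformOfFintype_eq` (an iid tuple of uniform coordinates is the
  uniform tuple).

## References

* O. Regev, *On lattices, learning with errors, random linear codes, and cryptography*, J. ACM 56
  (2009), §2 (independent samples). [RegevLWE2009]
* S. Arora, B. Barak, *Computational Complexity: A Modern Approach*, CUP 2009, Def. 7.1 (the random
  string of a probabilistic machine). [AroraBarak2009]
-/

noncomputable section

open scoped ENNReal

namespace Literature.Computability.Cryptography

namespace LWE

open Literature.Probability.Distributions Finset

/-! ### Zipping independent iid nests -/

section Zip

variable {α β : Type}

/-- **Depth 1**: `(A^{⊗n} ⊗ B^{⊗n}).map zip = (A ⊗ B)^{⊗n}`. [cite: RegevLWE2009, §2 (independent samples)] -/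
theorem zip_iid₁ (A : PMF α) (B : PMF β) (n : ℕ) :
    (prodLaw (iidPMF A n) (iidPMF B n)).map (fun x i => (x.1 i, x.2 i)) = iidPMF (prodLaw A B) n :=
  prodLaw_iidPMF_map_zip A B n

/-- **Depth 2.** [cite: RegevLWE2009, §2 (independent samples)] -/
theorem zip_iid₂ (A : PMF α) (B : PMF β) (m n : ℕ) :
    (prodLaw (iidPMF (iidPMF A m) n) (iidPMF (iidPMF B m) n)).map (fun x i j => (x.1 i j, x.2 i j)) =
      iidPMF (iidPMF (prodLaw A B) m) n := by
  rw [← zip_iid₁ A B m, ← iidPMF_map, ← zip_iid₁ (iidPMF A m) (iidPMF B m) n, PMF.map_comp]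
  rfl

/-- **Depth 3.** [cite: RegevLWE2009, §2 (independent samples)] -/
theorem zip_iid₃ (A : PMF α) (B : PMF β) (l m n : ℕ) :
    (prodLaw (iidPMF (iidPMF (iidPMF A l) m) n) (iidPMF (iidPMF (iidPMF B l) m) n)).map
        (fun x i j k => (x.1 i j k, x.2 i j k)) =
      iidPMF (iidPMF (iidPMF (prodLaw A B) l) m) n := by
  rw [← zip_iid₂ A B l m, ← iidPMF_map, ← zip_iid₁ (iidPMF (iidPMF A l) m) (iidPMF (iidPMF B l) m) n, PMF.map_comp]
  rfl

/-- **Depth 4.** [cite: RegevLWE2009, §2 (independent samples)] -/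
theorem zip_iid₄ (A : PMF α) (B : PMF β) (k l m n : ℕ) :
    (prodLaw (iidPMF (iidPMF (iidPMF (iidPMF A k) l) m) n) (iidPMF (iidPMF (iidPMF (iidPMF B k) l) m) n)).map
        (fun x i j r q => (x.1 i j r q, x.2 i j r q)) =
      iidPMF (iidPMF (iidPMF (iidPMF (prodLaw A B) k) l) m) n := by
  rw [← zip_iid₃ A B k l m, ← iidPMF_map,
    ← zip_iid₁ (iidPMF (iidPMF (iidPMF A k) l) m) (iidPMF (iidPMF (iidPMF B k) l) m) n, PMF.map_comp]
  rfl

end Zip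

/-! ### Nested consecutive blocks -/

section Blocks

variable {α : Type}

/-- Two levels of consecutive blocks of a stream of length `a·(b·c)`. [folklore] -/
def blocks₂ (a b c : ℕ) (S : Fin (a * (b * c)) → α) : Fin a → Fin b → Fin c → α :=
  fun i => blocksOf b c (blocksOf a (b * c) S i)

/-- Three levels. [folklore] -/
def blocks₃ (a b c d : ℕ) (S : Fin (a * (b * (c * d))) → α) : Fin a → Fin b → Fin c → Fin d → α :=
  fun i => blocks₂ b c d (blocksOf a (b * (c * d)) S i)

/-- Four levels. [folklore] -/
def blocks₄ (a b c d f : ℕ) (S : Fin (a * (b * (c * (d * f)))) → α) : Fin a → Fin b → Fin c → Fin d → Fin f → α :=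
  fun i => blocks₃ b c d f (blocksOf a (b * (c * (d * f))) S i)

/-- **Two levels of blocks of an iid stream are an iid nest.** [cite: RegevLWE2009, §2 (independent samples)] -/
theorem iidPMF_map_blocks₂ (P : PMF α) (a b c : ℕ) :
    (iidPMF P (a * (b * c))).map (blocks₂ a b c) = iidPMF (iidPMF (iidPMF P c) b) a := by
  rw [← iidPMF_map_blocksOf P b c, ← iidPMF_map, ← iidPMF_map_blocksOf P a (b * c), PMF.map_comp]
  rfl

/-- Three levels. [cite: RegevLWE2009, §2 (independent samples)] -/
theorem iidPMF_map_blocks₃ (P : PMF α) (a b c d : ℕ) :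
    (iidPMF P (a * (b * (c * d)))).map (blocks₃ a b c d) = iidPMF (iidPMF (iidPMF (iidPMF P d) c) b) a := by
  rw [← iidPMF_map_blocks₂ P b c d, ← iidPMF_map, ← iidPMF_map_blocksOf P a (b * (c * d)), PMF.map_comp]
  rfl

/-- Four levels. [cite: RegevLWE2009, §2 (independent samples)] -/
theorem iidPMF_map_blocks₄ (P : PMF α) (a b c d f : ℕ) :
    (iidPMF P (a * (b * (c * (d * f))))).map (blocks₄ a b c d f) =
      iidPMF (iidPMF (iidPMF (iidPMF (iidPMF P f) d) c) b) a := by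
  rw [← iidPMF_map_blocks₃ P b c d f, ← iidPMF_map, ← iidPMF_map_blocksOf P a (b * (c * (d * f))), PMF.map_comp]
  rfl

/-- **Three consecutive segments of an iid stream are independent iid streams.** [cite: RegevLWE2009, §2 (independent samples)] -/
theorem iidPMF_map_split₃ (P : PMF α) (a b c : ℕ) :
    (iidPMF P (a + (b + c))).map (fun S => ((Fin.appendEquiv a (b + c)).symm S).map id (Fin.appendEquiv b c).symm) =
      prodLaw (iidPMF P a) (prodLaw (iidPMF P b) (iidPMF P c)) := by
  rw [← iidPMF_map_appendEquiv_symm P b c, ← PMF.map_id (iidPMF P a), ← prodLaw_map_prodMap,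
    ← iidPMF_map_appendEquiv_symm P a (b + c), PMF.map_comp]
  rfl

end Blocks

/-! ### Uniform chunks of coins as uniform residues mod `2ᵉ` -/

section Chunk

variable (e : ℕ)

/-- The chunk of `e` coins as a number `< 2ᵉ` (binary, coin `i` the digit of `2ⁱ`). [folklore] -/
def chunkFin (c : Fin e → Bool) : Fin (2 ^ e) := finFunctionFinEquiv fun i => (finTwoEquiv.symm (c i))

/-- **The residue mod `2ᵉ` whose binary digits are the chunk.** [cite: AroraBarak2009, Def. 7.1] -/
def chunkVal (c : Fin e → Bool) : ZMod (2 ^ e) := ((chunkFin e c : ℕ) : ZMod (2 ^ e))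

/-- The value of the chunk: `∑ᵢ cᵢ 2ⁱ`. [folklore] -/
theorem val_chunkFin (c : Fin e → Bool) : (chunkFin e c : ℕ) = ∑ i : Fin e, (if c i then 1 else 0) * 2 ^ (i : ℕ) := by
  rw [chunkFin, finFunctionFinEquiv_apply]
  refine Finset.sum_congr rfl fun i _ => ?_
  cases c i <;> simp [finTwoEquiv]

/-- `chunkVal` is injective (distinct numbers `< 2ᵉ` are distinct residues). [folklore] -/
theorem chunkVal_injective : Function.Injective (chunkVal e) := by
  intro c c' h
  have h1 : ((chunkFin e c : ℕ) : ZMod (2 ^ e)).val = ((chunkFin e c' : ℕ) : ZMod (2 ^ e)).val := by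
    unfold chunkVal at h
    rw [h]
  rw [ZMod.val_natCast, ZMod.val_natCast, Nat.mod_eq_of_lt (chunkFin e c).2, Nat.mod_eq_of_lt (chunkFin e c').2] at h1
  have h2 : chunkFin e c = chunkFin e c' := Fin.ext h1
  unfold chunkFin at h2
  have h3 := finFunctionFinEquiv.injective h2
  funext i
  exact finTwoEquiv.symm.injective (congrFun h3 i)

/-- **A uniform chunk of `e` coins is a uniform residue mod `2ᵉ`.** [cite: AroraBarak2009, Def. 7.1] -/
theorem uniformOfFintype_map_chunkVal :
    (PMF.uniformOfFintype (Fin e → Bool)).map (chunkVal e) = PMF.uniformOfFintype (ZMod (2 ^ e)) := by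
  refine uniformOfFintype_map_of_bijective ((Fintype.bijective_iff_injective_and_card _).2 ⟨chunkVal_injective e, ?_⟩)
  rw [Fintype.card_fun, Fintype.card_bool, Fintype.card_fin, ZMod.card]

end Chunk

/-! ### Iid uniform coordinates -/

section IidUniform

variable {β : Type} [Fintype β] [Nonempty β]

/-- **An iid tuple of uniform coordinates is the uniform tuple.** [folklore] -/
theorem iidPMF_uniformOfFintype_eq (n : ℕ) :
    iidPMF (PMF.uniformOfFintype β) n = PMF.uniformOfFintype (Fin n → β) := by
  classical
  rw [← piLaw_const_eq_iidPMF, uniformOfFintype_arrow_eq_piLaw]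

end IidUniform

end LWE

end Literature.Computability.Cryptography

end
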